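import Literature.Analysis.SpecialFunctions.ShiftedGaussLatticeSum
import HarnessLib

/-!
# Tilted theta series: Poisson summation in real form, positivity, two-sided bounds

For `s > 0` and a real "tilt" `b`:

* `summable_exp_neg_mul_sq_mul_cos` — `n ↦ e^{-s n²} cos(b n)` is summable over `ℤ`;
* `tsum_exp_neg_mul_sq_mul_cos` — **`Σ_{n∈ℤ} e^{-s n²} cos(b n) = √(π/s) · Σ_{p∈ℤ} e^{-(b - 2πp)²/(4s)}`**
  (Jacobi's imaginary transformation = Poisson summation for the Gaussian, written for a theta
  series with a real twist; the right-hand side is its "charge representation": a sum of POSITIVE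
  Gaussians centred at the lifts of `b` modulo `2π`);
* `tsum_exp_neg_mul_sq_mul_cos_pos` — hence the tilted theta series is positive, with the explicit
  bounds `√(π/s) e^{-(b-2πp₀)²/(4s)} ≤ Σ ≤ G(s) = Σ_{n∈ℤ} e^{-s n²}`
  (`sqrt_mul_exp_le_tsum_exp_neg_mul_sq_mul_cos`, `tsum_exp_neg_mul_sq_mul_cos_le_gaussLatticeSum`).

All statements are folklore; theorems only. Mathlib: `Complex.tsum_exp_neg_quadratic`. In the tree the
same identity appears read from the Gaussian side (`ShiftedGaussLatticeSum`) and in complex/`fourier`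
dress (`Literature.Analysis.FunctionSpaces.Torus.exists_pos_tsum_fourier_mul_exp`).
-/

noncomputable section

open Real Complex

namespace Literature.Analysis.SpecialFunctions

/-- The summand of `Complex.tsum_exp_neg_quadratic` with `a = s/π`, `b' = I b/(2π)` is
`exp(-s n² + i b n)`. [folklore] -/
theorem cexp_tilted_gauss_term (s b : ℝ) (n : ℤ) :
    cexp (-π * ((s / π : ℝ) : ℂ) * (n : ℂ) ^ 2 + 2 * π * (I * ((b / (2 * π) : ℝ) : ℂ)) * n) =
      cexp (((-(s * (n : ℝ) ^ 2) : ℝ) : ℂ) + ((b * n : ℝ) : ℂ) * I) := by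
  congr 1
  have hπ : (π : ℂ) ≠ 0 := ofReal_ne_zero.mpr Real.pi_pos.ne'
  push_cast
  field_simp

/-- The dual summand: `exp(-π/a (n + I b')²) = e^{-(b - 2πn)²/(4s)}` for `a = s/π`, `b' = I b/(2π)`
(a positive real number). [folklore] -/
theorem cexp_dual_tilted_gauss_term {s : ℝ} (hs : 0 < s) (b : ℝ) (n : ℤ) :
    cexp (-π / ((s / π : ℝ) : ℂ) * ((n : ℂ) + I * (I * ((b / (2 * π) : ℝ) : ℂ))) ^ 2) =
      ((rexp (-((b - 2 * π * n) ^ 2 / (4 * s))) : ℝ) : ℂ) := by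
  rw [Complex.ofReal_exp]
  congr 1
  have hπ : (π : ℂ) ≠ 0 := ofReal_ne_zero.mpr Real.pi_pos.ne'
  have hs' : (s : ℂ) ≠ 0 := ofReal_ne_zero.mpr hs.ne'
  rw [← mul_assoc, I_mul_I]
  push_cast
  field_simp
  ring

/-- **Summability of the tilted theta series** `Σ_{n∈ℤ} e^{-s n²} cos(b n)`, `s > 0`. [folklore] -/
theorem summable_exp_neg_mul_sq_mul_cos {s : ℝ} (hs : 0 < s) (b : ℝ) :
    Summable fun n : ℤ => rexp (-(s * (n : ℝ) ^ 2)) * Real.cos (b * n) := by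
  have h0 : Summable fun n : ℤ => rexp (-(s * (n : ℝ) ^ 2)) :=
    (tsum_exp_neg_mul_sq_le hs 0).1.congr fun n => by rw [add_zero]
  refine Summable.of_norm (Summable.of_nonneg_of_le (fun n => norm_nonneg _) (fun n => ?_) h0)
  rw [norm_mul, Real.norm_eq_abs, Real.norm_eq_abs, abs_of_pos (Real.exp_pos _)]
  exact mul_le_of_le_one_right (Real.exp_pos _).le (Real.abs_cos_le_one _)

/-- **Summability of the dual (charge) series** `Σ_{p∈ℤ} e^{-(b-2πp)²/(4s)}`, `s > 0`. [folklore] -/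
theorem summable_exp_neg_sq_sub_div {s : ℝ} (hs : 0 < s) (b : ℝ) :
    Summable fun p : ℤ => rexp (-((b - 2 * π * p) ^ 2 / (4 * s))) := by
  have h := (tsum_exp_neg_mul_sq_le (a := π ^ 2 / s) (by positivity) (-(b / (2 * π)))).1
  refine h.congr fun p => ?_
  congr 1
  have hπ : (π : ℝ) ≠ 0 := Real.pi_pos.ne'
  field_simp
  ring

/-- **Poisson summation for the tilted theta series (real form)**:
`Σ_{n∈ℤ} e^{-s n²} cos(b n) = √(π/s) · Σ_{p∈ℤ} e^{-(b - 2πp)²/(4s)}` for `s > 0`, `b ∈ ℝ`.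
[folklore] (Jacobi's imaginary transformation; Mathlib `Complex.tsum_exp_neg_quadratic` with
`a = s/π`, `b' = ib/(2π)`, then real parts.) -/
theorem tsum_exp_neg_mul_sq_mul_cos {s : ℝ} (hs : 0 < s) (b : ℝ) :
    ∑' n : ℤ, rexp (-(s * (n : ℝ) ^ 2)) * Real.cos (b * n) =
      Real.sqrt (π / s) * ∑' p : ℤ, rexp (-((b - 2 * π * p) ^ 2 / (4 * s))) := by
  have ha : 0 < (((s / π : ℝ) : ℂ)).re := by
    rw [ofReal_re]; exact div_pos hs Real.pi_pos
  have key := Complex.tsum_exp_neg_quadratic ha (I * ((b / (2 * π) : ℝ) : ℂ))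
  simp only [cexp_tilted_gauss_term s b, cexp_dual_tilted_gauss_term hs b,
    one_div_cpow_half_eq hs] at key
  rw [← ofReal_tsum, ← ofReal_mul] at key
  have hsum : Summable fun n : ℤ =>
      cexp (((-(s * (n : ℝ) ^ 2) : ℝ) : ℂ) + ((b * n : ℝ) : ℂ) * I) := by
    have h0 : Summable fun n : ℤ => rexp (-(s * (n : ℝ) ^ 2)) :=
      (tsum_exp_neg_mul_sq_le hs 0).1.congr fun n => by rw [add_zero]
    refine Summable.of_norm (h0.congr fun n => ?_)
    rw [Complex.norm_exp]
    simp only [add_re, ofReal_re, mul_re, I_re, I_im, ofReal_im, mul_zero, mul_one, sub_self,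
      add_zero]
  have hre := congrArg Complex.re key
  rw [Complex.re_tsum hsum, ofReal_re] at hre
  rw [← hre]
  refine tsum_congr fun n => ?_
  rw [Complex.exp_re]
  simp only [add_re, add_im, ofReal_re, ofReal_im, mul_re, mul_im, I_re, I_im, mul_zero, mul_one,
    sub_self, add_zero, zero_add]

/-- **The tilted theta series is positive**: `0 < Σ_{n∈ℤ} e^{-s n²} cos(b n)` for `s > 0` and
every real `b`. [folklore] -/
theorem tsum_exp_neg_mul_sq_mul_cos_pos {s : ℝ} (hs : 0 < s) (b : ℝ) :
    0 < ∑' n : ℤ, rexp (-(s * (n : ℝ) ^ 2)) * Real.cos (b * n) := by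
  rw [tsum_exp_neg_mul_sq_mul_cos hs b]
  exact mul_pos (Real.sqrt_pos.mpr (div_pos Real.pi_pos hs))
    ((summable_exp_neg_sq_sub_div hs b).tsum_pos (fun p => (Real.exp_pos _).le) 0
      (Real.exp_pos _))

/-- **Lower bound by one charge sector**: `√(π/s) · e^{-(b-2πp₀)²/(4s)} ≤ Σ_{n∈ℤ} e^{-s n²} cos(b n)`
for every `p₀ ∈ ℤ`. [folklore] -/
theorem sqrt_mul_exp_le_tsum_exp_neg_mul_sq_mul_cos {s : ℝ} (hs : 0 < s) (b : ℝ) (p₀ : ℤ) :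
    Real.sqrt (π / s) * rexp (-((b - 2 * π * p₀) ^ 2 / (4 * s))) ≤
      ∑' n : ℤ, rexp (-(s * (n : ℝ) ^ 2)) * Real.cos (b * n) := by
  rw [tsum_exp_neg_mul_sq_mul_cos hs b]
  refine mul_le_mul_of_nonneg_left ?_ (Real.sqrt_nonneg _)
  exact (summable_exp_neg_sq_sub_div hs b).le_tsum p₀ fun p _ => (Real.exp_pos _).le

/-- **Upper bound by the untilted series**: `Σ_{n∈ℤ} e^{-s n²} cos(b n) ≤ G(s) = Σ_{n∈ℤ} e^{-s n²}`
(`gaussLatticeSum`; with `gaussLatticeSum_le`: `≤ 1 + 2/(e^s - 1)`). [folklore] -/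
theorem tsum_exp_neg_mul_sq_mul_cos_le_gaussLatticeSum {s : ℝ} (hs : 0 < s) (b : ℝ) :
    ∑' n : ℤ, rexp (-(s * (n : ℝ) ^ 2)) * Real.cos (b * n) ≤ gaussLatticeSum s := by
  have h0 : Summable fun n : ℤ => rexp (-(s * (n : ℝ) ^ 2)) :=
    (tsum_exp_neg_mul_sq_le hs 0).1.congr fun n => by rw [add_zero]
  rw [gaussLatticeSum]
  exact Summable.tsum_le_tsum (fun n => mul_le_of_le_one_right (Real.exp_pos _).le (Real.cos_le_one _))
    (summable_exp_neg_mul_sq_mul_cos hs b) h0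

/-! ## The sine series vanishes; complex form of the tilted theta series -/

/-- **The odd (sine) tilted series vanishes**: `Σ_{n∈ℤ} e^{-s n²} sin(b n) = 0` (the summand is odd in `n`;
no summability hypothesis is needed for this `tsum` identity). [folklore] -/
theorem tsum_exp_neg_mul_sq_mul_sin (s b : ℝ) :
    ∑' n : ℤ, rexp (-(s * (n : ℝ) ^ 2)) * Real.sin (b * n) = 0 := by
  set f : ℤ → ℝ := fun n => rexp (-(s * (n : ℝ) ^ 2)) * Real.sin (b * n) with hf
  have h1 : ∑' n : ℤ, f (-n) = ∑' n : ℤ, f n := (Equiv.neg ℤ).tsum_eq f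
  have h2 : ∑' n : ℤ, f (-n) = -∑' n : ℤ, f n := by
    rw [← tsum_neg]
    refine tsum_congr fun n => ?_
    simp only [hf, Int.cast_neg, mul_neg, Real.sin_neg, neg_sq]
  show ∑' n : ℤ, f n = 0
  linarith

/-- **Summability of the complex tilted theta series** `Σ_{n∈ℤ} exp(-s n² + i b n)`, `s > 0`. [folklore] -/
theorem summable_cexp_neg_mul_sq_add_mul_I {s : ℝ} (hs : 0 < s) (b : ℝ) :
    Summable fun n : ℤ => cexp (((-(s * (n : ℝ) ^ 2) : ℝ) : ℂ) + ((b * n : ℝ) : ℂ) * I) := by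
  have h0 : Summable fun n : ℤ => rexp (-(s * (n : ℝ) ^ 2)) :=
    (tsum_exp_neg_mul_sq_le hs 0).1.congr fun n => by rw [add_zero]
  refine Summable.of_norm (h0.congr fun n => ?_)
  rw [Complex.norm_exp]
  simp only [add_re, ofReal_re, mul_re, I_re, I_im, ofReal_im, mul_zero, mul_one, sub_self,
    add_zero]

/-- **The complex tilted theta series is the real number `Σ e^{-s n²} cos(b n)`**:
`Σ_{n∈ℤ} exp(-s n² + i b n) = Σ_{n∈ℤ} e^{-s n²} cos(b n)` (real part the cosine series, imaginary part the
vanishing sine series). [folklore] -/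
theorem tsum_cexp_neg_mul_sq_add_mul_I {s : ℝ} (hs : 0 < s) (b : ℝ) :
    ∑' n : ℤ, cexp (((-(s * (n : ℝ) ^ 2) : ℝ) : ℂ) + ((b * n : ℝ) : ℂ) * I) =
      ((∑' n : ℤ, rexp (-(s * (n : ℝ) ^ 2)) * Real.cos (b * n) : ℝ) : ℂ) := by
  have hsum := summable_cexp_neg_mul_sq_add_mul_I hs b
  apply Complex.ext
  · rw [Complex.re_tsum hsum, ofReal_re]
    refine tsum_congr fun n => ?_
    rw [Complex.exp_re]
    simp only [add_re, add_im, ofReal_re, ofReal_im, mul_re, mul_im, I_re, I_im, mul_zero, mul_one,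
      sub_self, add_zero, zero_add]
  · rw [Complex.im_tsum hsum, ofReal_im, ← tsum_exp_neg_mul_sq_mul_sin s b]
    refine tsum_congr fun n => ?_
    rw [Complex.exp_im]
    simp only [add_re, add_im, ofReal_re, ofReal_im, mul_re, mul_im, I_re, I_im, mul_zero, mul_one,
      sub_self, add_zero, zero_add]

/-- **Complex form, packaged**: for `s > 0` the series `Σ_{n∈ℤ} exp(-s n² + i b n)` is summable, has positive
real part and zero imaginary part. [folklore] -/
theorem tsum_cexp_neg_mul_sq_add_mul_I_pos {s : ℝ} (hs : 0 < s) (b : ℝ) :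
    0 < (∑' n : ℤ, cexp (((-(s * (n : ℝ) ^ 2) : ℝ) : ℂ) + ((b * n : ℝ) : ℂ) * I)).re ∧
      (∑' n : ℤ, cexp (((-(s * (n : ℝ) ^ 2) : ℝ) : ℂ) + ((b * n : ℝ) : ℂ) * I)).im = 0 := by
  rw [tsum_cexp_neg_mul_sq_add_mul_I hs b, ofReal_re, ofReal_im]
  exact ⟨tsum_exp_neg_mul_sq_mul_cos_pos hs b, rfl⟩

end Literature.Analysis.SpecialFunctions
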